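import Literature.MathematicalPhysics.StatisticalMechanics.PeriodicConfigurationSums
import Literature.MathematicalPhysics.StatisticalMechanics.CrystallizationSymmetries

/-!
# Crux `ChessboardParticlePlanes.LjBilayerHcp` (stmt-AtomisticToContinuum-6710), line `Sketch`, stub S1
# `stub_presentation` — presentation invariance of the energy per particle

The energy per particle `(2·#F)⁻¹ ∑_{x ∈ F} ∑_{y ∈ F+G, y ≠ x} V |x - y|` of a periodic configuration
(Blanc–Lewin 2015, (23)) depends only on its point set `F + G`, and is unchanged by a translation of the
point set.  [folklore]

PROOF SKETCH.  (1) Translation: `B'' := (B'.lattice, B'.motif + v)` has `B''.points = B'.points + v` and the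
same energy as `B'` term by term (`dist (x+v) (y+v) = dist x y`, re-index the `tsum` by `y ↦ y + v`).  So it
suffices to treat `B.points = B''.points` (same point set `S`, two presentations `(L, F)`, `(L', F')`).
(2) Site energies `ε(x) := ∑' y : {y // y ∈ S ∧ y ≠ x}, V (dist x y)` satisfy `ε(x + g) = ε(x)` for every
`g` with `S + g = S` (`Equiv.tsum_eq` with `y ↦ y + g`; no summability needed), in particular for `g ∈ L ∪ L'`.
(3) `M := L ⊓ L'` has finite index in `L` and in `L'`: for `g' ∈ L'` and `x₀ ∈ F`, `x₀ + g' ∈ S = F + L`, so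
`L' ⊆ (F - x₀) + L`, finitely many `L`-cosets; hence `L'/(L ⊓ L')` is finite (inject into those cosets);
symmetrically for `L`.  (4) With coset representatives `R ⊂ L` of `L/M` and `R' ⊂ L'` of `L'/M`, the finite
sets `A := F + R` and `A' := F' + R'` are both systems of representatives of `S` modulo `M`; so there is a
bijection `φ : A → A'` with `φ z - z ∈ M`, whence `∑_A ε = ∑_{A'} ε` and `#A = #A'`; and `∑_A ε = #R · ∑_F ε`,
`#A = #R · #F` (resp. primed).  Divide.

In the Lean proof step (1) is the tree's `PeriodicConfiguration.translate` /
`energyPerParticle_translate` (`CrystallizationSymmetries.lean`); steps (2)–(4) are the lemmas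
`presentation_*` below, with systems of representatives phrased as finite families `p : I → S`
(here `F × R → S`, `(x, r) ↦ x + r`) meeting every class modulo `M` exactly once.
-/

noncomputable section

open scoped BigOperators Classical

namespace Summit.AtomisticToContinuum.Crystallization.Theorems.LjBilayerHcpSketch

open Literature.MathematicalPhysics.StatisticalMechanics

variable {d : ℕ}

/-! ## Site energies are invariant under translations of the point set -/

/-- Translating the point set of a periodic configuration by a period leaves it invariant:
`(F + G) + g = F + G` for `g ∈ G`. [folklore] -/
theorem presentation_image_add_points (P : PeriodicConfiguration d)
    {g : EuclideanSpace ℝ (Fin d)} (hg : g ∈ P.lattice) :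
    (fun x => x + g) '' P.points = P.points := by
  ext z
  constructor
  · rintro ⟨w, hw, rfl⟩
    exact P.add_mem_points hw hg
  · intro hz
    refine ⟨z - g, ?_, sub_add_cancel z g⟩
    simpa [sub_eq_add_neg] using P.add_mem_points hz (P.lattice.neg_mem hg)

/-- Site energies are translation covariant: the site energy of `x + v` in the translated point
set `S + v` is the site energy of `x` in `S` (re-index the `tsum` by the bijection `y ↦ y + v`;
no summability is needed). [folklore] -/
theorem presentation_tsum_translate (V : ℝ → ℝ) {S T : Set (EuclideanSpace ℝ (Fin d))}
    (x v : EuclideanSpace ℝ (Fin d)) (hT : T = (fun y => y + v) '' S) :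
    ∑' y : {y // y ∈ T ∧ y ≠ x + v}, V (dist (x + v) y.1) =
      ∑' y : {y // y ∈ S ∧ y ≠ x}, V (dist x y.1) := by
  subst hT
  let e : {y // y ∈ S ∧ y ≠ x} ≃ {y // y ∈ (fun y => y + v) '' S ∧ y ≠ x + v} :=
    (Equiv.addRight v).subtypeEquiv fun y => by
      simp only [Equiv.coe_addRight, ne_eq, add_left_inj, (add_left_injective v).mem_set_image]
  rw [← Equiv.tsum_eq e]
  refine tsum_congr fun y => ?_
  simp [e, Equiv.subtypeEquiv_apply, dist_add_right]

/-- Site energies of a periodic configuration are invariant under its lattice of periods: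
`ε(x + g) = ε(x)` for `g ∈ G`. [folklore] -/
theorem presentation_tsum_add_period (V : ℝ → ℝ) (P : PeriodicConfiguration d)
    (x : EuclideanSpace ℝ (Fin d)) {g : EuclideanSpace ℝ (Fin d)} (hg : g ∈ P.lattice) :
    ∑' y : {y // y ∈ P.points ∧ y ≠ x + g}, V (dist (x + g) y.1) =
      ∑' y : {y // y ∈ P.points ∧ y ≠ x}, V (dist x y.1) :=
  presentation_tsum_translate V x g (presentation_image_add_points P hg).symm

/-! ## Systems of representatives modulo a subgroup -/

/-- **Two finite systems of representatives of the same set `S` modulo a subgroup `M` carry the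
same sum of any `M`-invariant function, and have the same cardinality.**  Here a system of
representatives is a finite family `p : I → S` meeting every class of `S` modulo `M` exactly once;
the bijection `I → I'` sends `i` to the representative of the class of `p i`. [folklore] -/
theorem presentation_repSystems_sum_eq {ι ι' : Type*}
    {M : Submodule ℤ (EuclideanSpace ℝ (Fin d))} {S : Set (EuclideanSpace ℝ (Fin d))}
    {I : Finset ι} {I' : Finset ι'} (p : ι → EuclideanSpace ℝ (Fin d))
    (p' : ι' → EuclideanSpace ℝ (Fin d)) {f : EuclideanSpace ℝ (Fin d) → ℝ}
    (hf : ∀ a b, a - b ∈ M → f a = f b)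
    (hI : ∀ i ∈ I, p i ∈ S) (hIc : ∀ z ∈ S, ∃ i ∈ I, z - p i ∈ M)
    (hIs : ∀ i ∈ I, ∀ j ∈ I, p i - p j ∈ M → i = j)
    (hI' : ∀ i ∈ I', p' i ∈ S) (hI'c : ∀ z ∈ S, ∃ i ∈ I', z - p' i ∈ M)
    (hI's : ∀ i ∈ I', ∀ j ∈ I', p' i - p' j ∈ M → i = j) :
    I.card = I'.card ∧ ∑ i ∈ I, f (p i) = ∑ i ∈ I', f (p' i) := by
  choose φ hφ hφm using fun i (hi : i ∈ I) => hI'c (p i) (hI i hi)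
  choose ψ hψ hψm using fun i (hi : i ∈ I') => hIc (p' i) (hI' i hi)
  have left : ∀ i hi, ψ (φ i hi) (hφ i hi) = i := fun i hi => by
    refine hIs _ (hψ _ _) i hi ?_
    have h1 := M.add_mem (hφm i hi) (hψm (φ i hi) (hφ i hi))
    rw [sub_add_sub_cancel] at h1
    exact sub_mem_comm_iff.1 h1
  have right : ∀ i hi, φ (ψ i hi) (hψ i hi) = i := fun i hi => by
    refine hI's _ (hφ _ _) i hi ?_
    have h1 := M.add_mem (hψm i hi) (hφm (ψ i hi) (hψ i hi))
    rw [sub_add_sub_cancel] at h1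
    exact sub_mem_comm_iff.1 h1
  exact ⟨Finset.card_bij' φ ψ hφ hψ left right,
    Finset.sum_bij' φ ψ hφ hψ left right fun i hi => hf _ _ (hφm i hi)⟩

/-! ## Refining a presentation along a subgroup of finite index of the lattice of periods -/

/-- If `R ⊂ G` is a system of representatives of the lattice of periods `G` modulo a subgroup
`M ≤ G`, then `F × R → F + G`, `(x, r) ↦ x + r`, is a system of representatives of the point
set `F + G` modulo `M`. [folklore] -/
theorem presentation_prod_repSystem (P : PeriodicConfiguration d)
    {M : Submodule ℤ (EuclideanSpace ℝ (Fin d))} (hM : M ≤ P.lattice)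
    {R : Finset (EuclideanSpace ℝ (Fin d))} (hR : ∀ r ∈ R, r ∈ P.lattice)
    (hRc : ∀ g ∈ P.lattice, ∃ r ∈ R, g - r ∈ M)
    (hRs : ∀ r ∈ R, ∀ r' ∈ R, r - r' ∈ M → r = r') :
    (∀ q ∈ P.motif ×ˢ R, q.1 + q.2 ∈ P.points) ∧
    (∀ z ∈ P.points, ∃ q ∈ P.motif ×ˢ R, z - (q.1 + q.2) ∈ M) ∧
    (∀ q ∈ P.motif ×ˢ R, ∀ q' ∈ P.motif ×ˢ R,
      (q.1 + q.2) - (q'.1 + q'.2) ∈ M → q = q') := by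
  refine ⟨fun q hq => ?_, fun z hz => ?_, fun q hq q' hq' hqq' => ?_⟩
  · rw [Finset.mem_product] at hq
    exact P.add_mem_points (P.mem_points_of_mem_motif hq.1) (hR _ hq.2)
  · obtain ⟨x, hx, g, hg, rfl⟩ := hz
    obtain ⟨r, hr, hgr⟩ := hRc g hg
    exact ⟨(x, r), Finset.mem_product.2 ⟨hx, hr⟩, by rwa [add_sub_add_left_eq_sub]⟩
  · rw [Finset.mem_product] at hq hq'
    have h1 : q.1 - q'.1 ∈ P.lattice := by
      have h2 : q.1 - q'.1 = (q.1 + q.2 - (q'.1 + q'.2)) - (q.2 - q'.2) := by abel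
      rw [h2]
      exact P.lattice.sub_mem (hM hqq') (P.lattice.sub_mem (hR _ hq.2) (hR _ hq'.2))
    have h3 : q.1 = q'.1 := P.eq_of_sub_mem _ hq.1 _ hq'.1 h1
    rw [h3, add_sub_add_left_eq_sub] at hqq'
    exact Prod.ext h3 (hRs _ hq.2 _ hq'.2 hqq')

/-- The sum of a `G`-invariant function over the refined motif `F + R` (`R ⊂ G` finite) is `#R`
times its sum over `F`. [folklore] -/
theorem presentation_sum_prod (P : PeriodicConfiguration d)
    {R : Finset (EuclideanSpace ℝ (Fin d))} (hR : ∀ r ∈ R, r ∈ P.lattice)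
    {f : EuclideanSpace ℝ (Fin d) → ℝ} (hf : ∀ x, ∀ g ∈ P.lattice, f (x + g) = f x) :
    ∑ q ∈ P.motif ×ˢ R, f (q.1 + q.2) = R.card * ∑ x ∈ P.motif, f x := by
  rw [Finset.sum_product, Finset.mul_sum]
  refine Finset.sum_congr rfl fun x _ => ?_
  rw [Finset.sum_congr rfl fun r hr => hf x r (hR r hr), Finset.sum_const, nsmul_eq_mul]

/-- **Finite index.**  If two periodic configurations `F + G` and `F' + G'` have the same point
set, then `G ⊓ G'` has finite index in `G`: there is a finite system of representatives `R ⊂ G`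
of `G` modulo `G ⊓ G'` (one for each motif point `y' ∈ F'` congruent modulo `G'` to some
`x₀' + g`, `g ∈ G`, where `x₀' ∈ F'` is fixed; so `#R ≤ #F'`). [folklore] -/
theorem presentation_exists_reps (P Q : PeriodicConfiguration d) (h : P.points = Q.points) :
    ∃ R : Finset (EuclideanSpace ℝ (Fin d)), (∀ r ∈ R, r ∈ P.lattice) ∧
      (∀ g ∈ P.lattice, ∃ r ∈ R, g - r ∈ P.lattice ⊓ Q.lattice) ∧
      (∀ r ∈ R, ∀ r' ∈ R, r - r' ∈ P.lattice ⊓ Q.lattice → r = r') := by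
  obtain ⟨x₀, hx₀⟩ := Q.motif_nonempty
  -- every period `g ∈ G` of `P` moves `x₀ ∈ F'` to a point congruent mod `G'` to a motif
  -- point of `Q`
  have key : ∀ g ∈ P.lattice, ∃ y ∈ Q.motif, x₀ + g - y ∈ Q.lattice := fun g hg => by
    refine Q.exists_sub_mem_lattice ?_
    rw [← h]
    exact P.add_mem_points (h ▸ Q.mem_points_of_mem_motif hx₀) hg
  -- choose, for each attained motif point, one such period
  have hex : ∀ y : EuclideanSpace ℝ (Fin d),
      (∃ g ∈ P.lattice, x₀ + g - y ∈ Q.lattice) →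
        ∃ g, g ∈ P.lattice ∧ x₀ + g - y ∈ Q.lattice := fun y hy => by
    obtain ⟨g, hg, hgy⟩ := hy
    exact ⟨g, hg, hgy⟩
  choose! σ hσP hσQ using hex
  refine ⟨(Q.motif.filter fun y => ∃ g ∈ P.lattice, x₀ + g - y ∈ Q.lattice).image σ,
    ?_, fun g hg => ?_, ?_⟩
  · intro r hr
    obtain ⟨y, hy, rfl⟩ := Finset.mem_image.1 hr
    exact hσP y (Finset.mem_filter.1 hy).2
  · obtain ⟨y, hy, hgy⟩ := key g hg
    have hPy : ∃ g ∈ P.lattice, x₀ + g - y ∈ Q.lattice := ⟨g, hg, hgy⟩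
    refine ⟨σ y, Finset.mem_image.2 ⟨y, Finset.mem_filter.2 ⟨hy, hPy⟩, rfl⟩,
      Submodule.mem_inf.2 ⟨P.lattice.sub_mem hg (hσP y hPy), ?_⟩⟩
    have h1 := Q.lattice.sub_mem hgy (hσQ y hPy)
    rwa [show x₀ + g - y - (x₀ + σ y - y) = g - σ y by abel] at h1
  · intro r hr r' hr' hrr'
    obtain ⟨y, hy, rfl⟩ := Finset.mem_image.1 hr
    obtain ⟨y', hy', rfl⟩ := Finset.mem_image.1 hr'
    obtain ⟨hy, hPy⟩ := Finset.mem_filter.1 hy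
    obtain ⟨hy', hPy'⟩ := Finset.mem_filter.1 hy'
    have h1 : y - y' ∈ Q.lattice := by
      have h2 := Q.lattice.add_mem (Q.lattice.sub_mem (Submodule.mem_inf.1 hrr').2 (hσQ y hPy))
        (hσQ y' hPy')
      rwa [show σ y - σ y' - (x₀ + σ y - y) + (x₀ + σ y' - y') = y - y' by abel] at h2
    rw [Q.eq_of_sub_mem y hy y' hy' h1]

/-! ## Presentation invariance -/

/-- **Two presentations of the same point set have the same energy per particle**: if
`F + G = F' + G'` as point sets then `(2·#F)⁻¹ ∑_F ε = (2·#F')⁻¹ ∑_{F'} ε`, for every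
pair potential and in every dimension (both equal the average of the site energy `ε` over the
finitely many classes of the point set modulo `G ⊓ G'`).
[folklore; Blanc–Lewin 2015 §2.1 (23)] -/
theorem presentation_energy_eq_of_points_eq (V : ℝ → ℝ) (P Q : PeriodicConfiguration d)
    (h : P.points = Q.points) : P.energyPerParticle V = Q.energyPerParticle V := by
  -- the site energy and its invariance under both lattices of periods
  set f : EuclideanSpace ℝ (Fin d) → ℝ :=
    fun x => ∑' y : {y // y ∈ P.points ∧ y ≠ x}, V (dist x y.1) with hf
  have hfP : ∀ x, ∀ g ∈ P.lattice, f (x + g) = f x := fun x g hg =>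
    presentation_tsum_add_period V P x hg
  have hfQ : ∀ x, ∀ g ∈ Q.lattice, f (x + g) = f x := fun x g hg => by
    simp only [hf]
    rw [h]
    exact presentation_tsum_add_period V Q x hg
  set M : Submodule ℤ (EuclideanSpace ℝ (Fin d)) := P.lattice ⊓ Q.lattice with hM
  have hfM : ∀ a b, a - b ∈ M → f a = f b := fun a b hab => by
    have h1 := hfP b (a - b) (Submodule.mem_inf.1 hab).1
    rwa [add_sub_cancel] at h1
  -- coset representatives of `G` and `G'` modulo `M = G ⊓ G'`
  obtain ⟨R, hRL, hRc, hRs⟩ := presentation_exists_reps P Q h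
  obtain ⟨R', hR'L, hR'c, hR's⟩ := presentation_exists_reps Q P h.symm
  have hMQ : Q.lattice ⊓ P.lattice = M := inf_comm _ _
  rw [hMQ] at hR'c hR's
  -- the two refined systems of representatives `F + R`, `F' + R'` of the point set modulo `M`
  obtain ⟨hA, hAc, hAs⟩ := presentation_prod_repSystem P inf_le_left hRL hRc hRs
  obtain ⟨hA', hA'c, hA's⟩ := presentation_prod_repSystem Q inf_le_right hR'L hR'c hR's
  rw [← h] at hA' hA'c
  obtain ⟨hcard, hsum⟩ := presentation_repSystems_sum_eq (M := M) (S := P.points)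
    (I := P.motif ×ˢ R) (I' := Q.motif ×ˢ R')
    (fun q : EuclideanSpace ℝ (Fin d) × EuclideanSpace ℝ (Fin d) => q.1 + q.2)
    (fun q : EuclideanSpace ℝ (Fin d) × EuclideanSpace ℝ (Fin d) => q.1 + q.2)
    hfM hA hAc hAs hA' hA'c hA's
  rw [Finset.card_product, Finset.card_product] at hcard
  rw [presentation_sum_prod P hRL hfP, presentation_sum_prod Q hR'L hfQ] at hsum
  -- the energies per particle in terms of `f`
  have eP : P.energyPerParticle V = (2 * (P.motif.card : ℝ))⁻¹ * ∑ x ∈ P.motif, f x := rfl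
  have eQ : Q.energyPerParticle V = (2 * (Q.motif.card : ℝ))⁻¹ * ∑ x ∈ Q.motif, f x := by
    unfold PeriodicConfiguration.energyPerParticle
    congr 1
    refine Finset.sum_congr rfl fun x _ => ?_
    simp only [hf]
    rw [h]
  rw [eP, eQ]
  -- bookkeeping: `#R · ∑_F f = #R' · ∑_{F'} f` and `#F · #R = #F' · #R'`, counts positive
  have hR0 : R.Nonempty := by
    obtain ⟨r, hr, -⟩ := hRc 0 P.lattice.zero_mem
    exact ⟨r, hr⟩
  have hR'0 : R'.Nonempty := by
    obtain ⟨r, hr, -⟩ := hR'c 0 Q.lattice.zero_mem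
    exact ⟨r, hr⟩
  have hr : (R.card : ℝ) ≠ 0 := by exact_mod_cast (Finset.card_pos.2 hR0).ne'
  have hr' : (R'.card : ℝ) ≠ 0 := by exact_mod_cast (Finset.card_pos.2 hR'0).ne'
  have hn : (P.motif.card : ℝ) ≠ 0 := by
    exact_mod_cast (Finset.card_pos.2 P.motif_nonempty).ne'
  have hn' : (Q.motif.card : ℝ) ≠ 0 := by
    exact_mod_cast (Finset.card_pos.2 Q.motif_nonempty).ne'
  have hcard' : (P.motif.card : ℝ) * R.card = Q.motif.card * R'.card := by exact_mod_cast hcard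
  rw [inv_mul_eq_div, inv_mul_eq_div, div_eq_div_iff (mul_ne_zero two_ne_zero hn)
    (mul_ne_zero two_ne_zero hn')]
  refine mul_left_cancel₀ (mul_ne_zero hr hr') ?_
  linear_combination (2 * (R'.card : ℝ) * Q.motif.card) * hsum
    - (2 * (R'.card : ℝ) * ∑ x ∈ Q.motif, f x) * hcard'

/-- **S1, presentation invariance.** If two periodic configurations have the same point set up to the
translation `v`, `B.points = B'.points + v`, then they have the same energy per particle, for every pair
potential and in every dimension. [folklore; Blanc–Lewin 2015 §2.1 (23)] -/
theorem stub_presentation :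
    ∀ {d : ℕ} (V : ℝ → ℝ) (B B' : PeriodicConfiguration d) (v : EuclideanSpace ℝ (Fin d)),
      B.points = (fun x => x + v) '' B'.points →
      B.energyPerParticle V = B'.energyPerParticle V := by
  intro d V B B' v hpts
  -- the translate `B'' = F' + v + G'` of `B'` has point set `B'.points + v = B.points` and the
  -- same energy per particle as `B'`
  have h1 : B.points = (B'.translate v).points := by
    rw [hpts]
    ext z
    rw [PeriodicConfiguration.mem_points_translate, Set.mem_image]
    constructor
    · rintro ⟨w, hw, rfl⟩
      rwa [add_sub_cancel_right]
    · intro hz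
      exact ⟨z - v, hz, sub_add_cancel z v⟩
  rw [presentation_energy_eq_of_points_eq V B (B'.translate v) h1,
    PeriodicConfiguration.energyPerParticle_translate]

end Summit.AtomisticToContinuum.Crystallization.Theorems.LjBilayerHcpSketch

end
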